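import Mathlib
import HarnessLib
import Literature.MathematicalPhysics.QuantumLattice.GrassmannGramBoundedSum
import Summits.HubbardSuperconductivity.HubbardSuperconductivity.Theorems.KLProgrammeKLRegimeEngineScaleZeroCovariance
import Summits.HubbardSuperconductivity.HubbardSuperconductivity.Theorems.KLProgrammeKLRegimeEnginePairTransferGridRunningStep

/-!
# Route `KLProgramme` — K3 VL child (stmt-HubbardSuperconductivity-23356 `KLRegimeVolumeLimitV17F3`), atom `stub_vl_HE1free`, LEVEL 0:
# the pulled-back covariance at the FIRST INFRARED CUTOFF `Λ₁ = klScale klE0 1 = e₀/4` is replica-Gram-bounded with an ABSOLUTE constant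

Cell `gate-hubbard-kl`, seat p3 (g20); VL lead k3c4-p1 g18, memo `HOME/hubbard-kl-k3c4-p1/HE1-GRANULARITY-g18.md` §2″ («(VL)-HE1-LEVEL0»).
The level-`0` datum of the VL tower read by `stub_vl_HE1free` is `𝒱_1[K] @ F_0`, with
`𝒱_1[K] = hubbardEffectiveActionCT … K Λ₁ = effAction C^K_{>Λ₁} (S·(V_N + 𝒩_{K,N}))` — ONE determinant-bounded Gaussian step from scale `∞`
down to `Λ₁` (it is NOT a sectorised step from `𝒱_0 @ F_0`: the slice `(Λ₁, Λ₀]` is outside `F_0`'s plateau).  The step's covariance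
hypothesis is the replica Gram bound of `S_Nᵀ C^K_{>Λ₁} S_N` on the `N = 4M` time grid.  The tree has it at `Λ₀ = e₀`
(`isGramBoundedR_scaleZero_of_frameOK`, absolute constant `√(2(7 + 1606732))`, k3c2-p1) and, for the partial slices
`C^K_{>Λ(t)} − C^K_{>Λₙ}`, k3c1's `klmg_isGramBoundedR_gridSub_partialSlice` (absolute constant `√6047`, any `n`, `t ∈ [0,1]`).  Writing
`C^K_{>Λ₁} = C^K_{>e₀} + (C^K_{>Λ₁} − C^K_{>e₀})` (the slice at `(n, t) = (0, 1)`) and adding the two Gram representations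
(Literature `IsGramBoundedR.add`, BGM 2006 (2.80)):

* **`isGramBoundedR_scaleOneCutoff_of_frameOK`** — for every admissible frame (`FrameOK R U N μ K`), `klBetaMin ≤ β ≤ L`, `2¹⁵ ≤ L`, every `M ≥ 1`:
  `IsGramBoundedR (S_Nᵀ · C^K_{>Λ₁} · S_N) (√(2(7 + 1606732)) + √6047)` — no `log M`, no `log β`; the direct route through
  `sum_one_sub_hubbardCutoffWeightCT_div_sqrt_le` would need `π/β ≤ Λ₁`, false for `β < 128π`, hence the composition.

Everything is proved; no definition, no sorry.  Nothing asserts HE1free, any stub, VL, K3 or superconductivity.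
[cite: BenfattoGiulianiMastropietro2006, §2.7 (2.77)–(2.80); PedraSalmhofer2008, Thm 2.4]
-/

noncomputable section

namespace Summit.HubbardSuperconductivity.HubbardSuperconductivity.Theorems.EngineV8

set_option linter.dupNamespace false -- summit = problem name (single-conjunct summit), D-0017

open Real Finset Literature.MathematicalPhysics.QuantumLattice Literature.Probability.LatticeModels
open Summit.HubbardSuperconductivity.HubbardSuperconductivity.Theorems.KLRegimeSplit
open Summit.HubbardSuperconductivity.HubbardSuperconductivity.Theorems.KLProgrammeLegKernels

/-- `Λ(1)` of the partial-slice parametrisation at `(n, t) = (0, 1)` is `Λ₁`, and `Λ₀ = e₀`. -/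
theorem klScale_zero_add_one_mul : klScale klE0 0 + 1 * (klScale klE0 (0 + 1) - klScale klE0 0) = klScale klE0 1 := by
  ring_nf

/-- **The pulled-back covariance at the first infrared cutoff `Λ₁ = e₀/4` is replica-Gram-bounded with an absolute constant.**
For every admissible frame (`FrameOK R U N μ K`), `klBetaMin ≤ β ≤ L`, `2¹⁵ ≤ L` and every Matsubara cutoff `M ≥ 1`:
`IsGramBoundedR ((hubbardGridSub L M β (4M))ᵀ · hubbardCovAboveCT L M β μ 0 K Λ₁ · hubbardGridSub L M β (4M)) (√(2(7+1606732)) + √6047)`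
(scale-`0` Gram of `C^K_{>e₀}` plus the partial-slice Gram of `C^K_{>Λ₁} − C^K_{>e₀}`). [cite: BenfattoGiulianiMastropietro2006, §2.7 (2.80)] -/
theorem isGramBoundedR_scaleOneCutoff_of_frameOK {R : RenConsts} {U : ℝ} {N : ℕ} {μ : ℝ} {K : TrigPolyC4v} (hK : FrameOK R U N μ K)
    {β : ℝ} (hβ : klBetaMin ≤ β) {L M : ℕ} [NeZero L] [NeZero M] (hL : (2 : ℝ) ^ 15 ≤ L) (hβL : β ≤ L) :
    IsGramBoundedR
      ((hubbardGridSub L M β (2 * (2 * M))).transpose * hubbardCovAboveCT L M β μ 0 K (klScale klE0 1) *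
        hubbardGridSub L M β (2 * (2 * M)))
      (Real.sqrt (2 * (7 + 1606732)) + Real.sqrt 6047) := by
  -- the scale-`0` piece `C^K_{>e₀}`
  have hA := isGramBoundedR_scaleZero_of_frameOK (L := L) (M := M) hK hβ hL hβL
  -- the partial slice `C^K_{>Λ₁} − C^K_{>e₀}` at `(n, t) = (0, 1)`
  have hB := klmg_isGramBoundedR_gridSub_partialSlice L M β μ K hK hβ hβL 0 (t := 1) ⟨zero_le_one, le_rfl⟩ (2 * (2 * M))
  rw [klScale_zero_add_one_mul, show klScale klE0 0 = klE0 by simp [klScale]] at hB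
  have hsum := hA.add hB (Real.sqrt_nonneg _)
  rwa [← Matrix.add_mul, ← Matrix.mul_add, add_sub_cancel] at hsum

end Summit.HubbardSuperconductivity.HubbardSuperconductivity.Theorems.EngineV8

end
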